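import Literature.NumberTheory.LFunctions.RobinAnalyticRH
import Literature.NumberTheory.LFunctions.ChebyshevThetaSqrtBounds
import Literature.NumberTheory.LFunctions.ButhePartialRH
import Literature.NumberTheory.DiophantineGeometry.NamedHypotheses
import HarnessLib

/-!
# Splittings — Robin finite lens, E1c⁻ part 1/4: the RH-FREE `θ`-inputs of Nicolas's lower inequality (2.18)
# (SPLIT-robin-finite gen 5; zero-definition raw form)

Cell rh-split, seat rh-split-robin-finite g5 (brief sha16 f79c5f09d8bcb036), card
`run/shared/lean/pub/rh-split/cards/SPLIT-robin-finite.md` §12; zero-definition raw form of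
`HOME/rh-split-robin-finite/SketchG5-E1c.lean` (sha16 a141f2e32dd4cace; referee CONTENT REPLAY PASS rh-split-ref g2
2026-08-27T03:02:44Z: farm rc 0 / 0 warn / 0 sorry, std axioms on `E1c.partialNicolasLower_PT`,
`E1c.nicolasLowerBetween_PT`, `E1c.schoenfeldThetaOn_of_buthe2016`), filed by rh-split-typer-1 g4.  The scratch's 15
interface `def`s (`nicolasEWith`, `SchoenfeldThetaOn`, `OffLineSumAt`, `budgetPw`, `PartialExplicitCorePwLower`,
`ExplicitFormulaFree`, `ZeroSplitBound`, `PsiSubThetaFree`, `termSum`, `OffLineSumOn`, `NicolasLowerBetween`,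
`PartialNicolasBetween`, `ZeroTailBound`, `lehmanH`, `lehmanTail`) are SPELLED OUT VERBATIM at every site; proofs are the
scratch's, with only the `unfold`/`rw` steps of the spelled-out abbreviations removed.
HONEST LABEL: «SPLITTING SEARCH over kernel-typed RH-EQUIVALENCES; a splitting A ∧ B ⟹ RH is CONDITIONAL bookkeeping
unless A and B are both proved; nothing here bears on the truth of RH.»

This part (RH-free throughout; `RiemannHypothesisUpTo` appears only as a HYPOTHESIS of the last theorem):
* S4 — the GLOBAL bound `ψ − θ ≤ 1.021√t + (4/3)t^{1/3}` for `t ≥ 599` WITHOUT `RiemannHypothesis`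
  (`psiSubThetaFree_holds`): the tree's kernel computation below `2³²` (`psi_sub_theta_le_of_lt_two_pow_32`) + the crude
  RH-free `θ(y) ≤ 1.0000379·y` (`theta_le_mul_free`, from the tree's named facts `Buthe2018_thm2_theta` [Büthe 2018 Thm 2]
  below `10¹⁹` and `BroadbentEtAl2021_theta_rel_1e19` [BKLNW 2021 §1.2] above) + Nicolas's `S₄(t) ≤ 0.3289`.  This replaces
  the tree's `Lemma24RH.psi_sub_theta_le hRH` (the hidden RH use (ψθ) of `Lemma24RH.logf_lowerRH`).
* The LOCAL `θ`-terms of (2.18) from the WINDOW hypothesis `∀ y ∈ [599, x], |θ y − y| ≤ √y log²y/(8π)` (scratch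
  `SchoenfeldThetaOn x`, spelled out): `theta_ge_four_fifths_of_window`, `sq_theta_sub_div_le_of_window`.
* Cor. 2.1 upper POINTWISE in `X` with a parametric `√t`-constant (`jk_partial_le`, RH-free).
* The window hypothesis DISCHARGED: below `10¹⁹` it reduces RH-free to the fixed finite range `[599, 1423]`
  (`schoenfeldThetaOn_of_buthe`, Büthe 2018 Thm 2 line 2); from `Buthe2016_thm2` + RH verified to height
  `3 000 175 332 800` (Platt–Trudgian 2021) it holds for every `x ≤ 2.169·10²⁵`, the endpoint `599` by right-continuity
  of the step function `θ` (`theta_eq_599`, `schoenfeldThetaOn_of_buthe2016`).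
Parts 2–4: `RobinFiniteE1cZeroSplit` (S2), `RobinFiniteE1cExplicitFormula` (S1), `RobinFiniteE1c` (composition + headlines).
-/

set_option linter.dupNamespace false

noncomputable section

open Complex Filter Set MeasureTheory Topology intervalIntegral
open scoped Real Chebyshev ComplexConjugate

namespace Summit.RiemannHypothesis.RiemannHypothesis.Theorems.Splittings.RobinFiniteE1c

open Literature.NumberTheory.LFunctions Literature.NumberTheory.DiophantineGeometry
open NicolasJ NicolasFz NicolasK NicolasJExplicit

/-! ### S4 (RH-free): `ψ − θ` from Büthe 2018 + Broadbent–Kadiri–Lumley–Ng–Wilk 2021 -/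

/-- RH-free crude global Chebyshev upper bound: `θ(y) ≤ (1 + 3.79·10⁻⁵)·y` for `y ≥ 0`
(Büthe 2018 below `10¹⁹`, Broadbent et al. 2021 above). -/
theorem theta_le_mul_free (hB : Buthe2018_thm2_theta) (hK : BroadbentEtAl2021_theta_rel_1e19)
    {y : ℝ} (hy : 0 ≤ y) : θ y ≤ 1.0000379 * y := by
  rcases lt_or_ge y 1 with h1 | h1
  · rw [Chebyshev.theta_eq_zero_of_le_one h1.le]; positivity
  rcases le_or_gt y ((10 : ℝ) ^ 19) with h19 | h19
  · have := hB.theta_lt h1 h19; linarith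
  · have h := hK.abs_sub_lt h19.le
    have hy0 : 0 < y := by linarith
    have hlog : 1 ≤ Real.log y := by
      rw [← Real.log_exp 1]
      refine Real.log_le_log (Real.exp_pos 1) ?_
      have := Real.exp_one_lt_d9
      linarith
    have hl2 : 1 ≤ Real.log y ^ 2 := by nlinarith
    have h' : 3.79e-5 * y / Real.log y ^ 2 ≤ 3.79e-5 * y := by
      rw [div_le_iff₀ (by positivity)]; nlinarith
    have := (abs_lt.1 h).2
    linarith

/-- **Case 3, RH-free** (`t ≥ 2¹⁰⁰`): `ψ(t) − θ(t) ≤ 1.021√t + (4/3)t^{1/3}` from `theta_le_mul_free` and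
Nicolas's `S₄(t) ≤ 0.3289`. -/
theorem psi_sub_theta_le_case3_free (hB : Buthe2018_thm2_theta) (hK : BroadbentEtAl2021_theta_rel_1e19)
    {t : ℝ} (ht : (2 : ℝ) ^ 32 ≤ t) :
    ψ t - θ t ≤ 1.021 * Real.sqrt t + 4 / 3 * t ^ ((1 : ℝ) / 3) := by
  have ht1 : 1 ≤ t := le_trans (by norm_num) ht
  have ht0 : 0 < t := by linarith
  have h16 : (2 : ℝ) ^ 4 ≤ t := le_trans (by norm_num) ht
  have hroot : ∀ k : ℕ, θ (t ^ ((1 : ℝ) / k)) ≤ 1.0000379 * t ^ ((1 : ℝ) / k) :=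
    fun k ↦ theta_le_mul_free hB hK (Real.rpow_nonneg ht0.le _)
  rw [NicolasPsiTheta.psi_sub_theta_eq h16, Real.sqrt_eq_rpow]
  have hS := NicolasPsiTheta.sum_rpow_sub_third_le_32 ht
  have h3 : 0 ≤ t ^ ((1 : ℝ) / 3) := by positivity
  have hsum : ∑ k ∈ Finset.Icc 4 ⌊Real.log t / Real.log 2⌋₊, θ (t ^ ((1 : ℝ) / k)) ≤
      1.0000379 * (t ^ ((1 : ℝ) / 3) * 0.3289) := by
    calc ∑ k ∈ Finset.Icc 4 ⌊Real.log t / Real.log 2⌋₊, θ (t ^ ((1 : ℝ) / k))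
        ≤ ∑ k ∈ Finset.Icc 4 ⌊Real.log t / Real.log 2⌋₊, 1.0000379 * t ^ ((1 : ℝ) / k) :=
          Finset.sum_le_sum fun k _ ↦ hroot k
      _ = 1.0000379 * (t ^ ((1 : ℝ) / 3) *
            ∑ k ∈ Finset.Icc 4 ⌊Real.log t / Real.log 2⌋₊, t ^ ((1 : ℝ) / k - 1 / 3)) := by
          rw [← Finset.mul_sum, NicolasPsiTheta.sum_rpow_eq_mul ht0]
      _ ≤ 1.0000379 * (t ^ ((1 : ℝ) / 3) * 0.3289) := by gcongr
  have h2 := hroot 2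
  have h3' := hroot 3
  simp only [Nat.cast_ofNat] at h2 h3'
  have hs0 : 0 ≤ t ^ ((1 : ℝ) / 2) := by positivity
  linarith

/-- **S4 PROVED (RH-free)** (scratch `PsiSubThetaFree`, spelled out): `ψ − θ ≤ 1.021√t + (4/3)t^{1/3}` for `t ≥ 599`,
from the kernel computation below `2³²` (`psi_sub_theta_le_of_lt_two_pow_32`) and the RH-free Case 3 above it, given the
two RH-free named `θ`-facts (Büthe 2018 Thm 2; BKLNW 2021 §1.2). -/
theorem psiSubThetaFree_holds :
    Buthe2018_thm2_theta → BroadbentEtAl2021_theta_rel_1e19 →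
    ∀ t : ℝ, 599 ≤ t → ψ t - θ t ≤ 1.021 * Real.sqrt t + 4 / 3 * t ^ ((1 : ℝ) / 3) := by
  intro hB hK t ht
  rcases lt_or_ge t ((2 : ℝ) ^ 32) with h32 | h32
  · have := psi_sub_theta_le_of_lt_two_pow_32 (by linarith) h32
    have hs0 : 0 ≤ Real.sqrt t := Real.sqrt_nonneg t
    linarith
  · exact psi_sub_theta_le_case3_free hB hK h32

/-! ### The local `θ`-terms from the window hypothesis; Cor. 2.1 upper pointwise in `X` -/

/-- The local `θ`-input, lower side (PROVED from the window hypothesis; copy of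
`Nicolas2012Sharp.theta_ge_four_fifths` with the window hypothesis on `[599, x]` in place of `Schoenfeld1976_theta hRH`). -/
theorem theta_ge_four_fifths_of_window {x : ℝ} (hW : ∀ y : ℝ, 599 ≤ y → y ≤ x → |θ y - y| ≤ √y * Real.log y ^ 2 / (8 * π)) (hx : 599 ≤ x) :
    4 / 5 * x ≤ θ x := by
  have hx0 : 0 < x := by linarith
  have h1 := hW x hx le_rfl
  have hδ := RobinAnalyticSharp.schoenfeldDelta_le hx
  rw [RobinAnalyticSharp.schoenfeldDelta] at hδ
  have hsx : 0 < √x := Real.sqrt_pos.2 hx0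
  have h2 : Real.log x ^ 2 ≤ 0.0666 * (8 * π * √x) := (div_le_iff₀ (by positivity)).1 hδ
  have hkey : √x * Real.log x ^ 2 / (8 * π) ≤ 0.0666 * x := by
    rw [div_le_iff₀ (by positivity)]
    have hx' : √x * √x = x := Real.mul_self_sqrt hx0.le
    calc √x * Real.log x ^ 2 ≤ √x * (0.0666 * (8 * π * √x)) := mul_le_mul_of_nonneg_left h2 hsx.le
      _ = 0.0666 * (√x * √x) * (8 * π) := by ring
      _ = 0.0666 * x * (8 * π) := by rw [hx']
  have := (abs_le.1 h1).1
  linarith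

/-- The local `θ`-input, the `S(x)²` term (PROVED from the window hypothesis; copy of
`Nicolas2012Sharp.sq_theta_sub_div_le`). -/
theorem sq_theta_sub_div_le_of_window {x : ℝ} (hW : ∀ y : ℝ, 599 ≤ y → y ≤ x → |θ y - y| ≤ √y * Real.log y ^ 2 / (8 * π)) (hx : 599 ≤ x) :
    (θ x - x) ^ 2 / (x ^ 2 * Real.log x) ≤ Real.log x ^ 3 / (64 * π ^ 2 * x) := by
  have hx0 : 0 < x := by linarith
  have hlx : 0 < Real.log x := Real.log_pos (by linarith)
  have h1 := abs_le.1 (hW x hx le_rfl)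
  have hsq : (θ x - x) ^ 2 ≤ (√x * Real.log x ^ 2 / (8 * π)) ^ 2 := sq_le_sq' h1.1 h1.2
  have hT : (√x * Real.log x ^ 2 / (8 * π)) ^ 2 = x * Real.log x ^ 4 / (64 * π ^ 2) := by
    rw [div_pow, mul_pow, Real.sq_sqrt hx0.le]; ring
  rw [hT] at hsq
  calc (θ x - x) ^ 2 / (x ^ 2 * Real.log x) ≤ (x * Real.log x ^ 4 / (64 * π ^ 2)) / (x ^ 2 * Real.log x) :=
        div_le_div_of_nonneg_right hsq (mul_nonneg (sq_nonneg x) hlx.le)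
    _ = Real.log x ^ 3 / (64 * π ^ 2 * x) := by
        rw [div_div, div_eq_div_iff (by positivity) (by positivity)]
        ring

/-- Cor. 2.1 upper, POINTWISE in `X` and with a parametric `√t`-constant `c ≥ 0` (PROVED, RH-free; the
middle of the tree's `NicolasK.cor21_upper`): if `ψ − θ ≤ c√t + (4/3)t^{1/3}` on `[x, ∞)` then
`∫_x^X (ψ − t) w₀ − ∫_x^X (θ − t) w₀ ≤ c·F_{1/2}(x) + (4/3)F_{1/3}(x)` for every `X ≥ x > 1`. -/
theorem jk_partial_le {c x X : ℝ} (hx : 1 < x) (hX : x ≤ X) (hc : 0 ≤ c)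
    (hψθ : ∀ t, x ≤ t → ψ t - θ t ≤ c * Real.sqrt t + 4 / 3 * t ^ ((1 : ℝ) / 3)) :
    (∫ t in x..X, (ψ t - t) * w0 t) - ∫ t in x..X, (θ t - t) * w0 t ≤
      c * (Fz (1 / 2 : ℝ) x).re + 4 / 3 * (Fz (1 / 3 : ℝ) x).re := by
  have hiψ := intervalIntegrable_R_mul_w0 hx hX
  have hiθ := intervalIntegrable_S_mul_w0 hx hX
  have hi2 := intervalIntegrable_rpow_mul_w0 (1 / 2) hx hX
  have hi3 := intervalIntegrable_rpow_mul_w0 (1 / 3) hx hX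
  rw [← intervalIntegral.integral_sub hiψ hiθ]
  have hsimp : ∫ t in x..X, ((ψ t - t) * w0 t - (θ t - t) * w0 t) =
      ∫ t in x..X, (ψ t - θ t) * w0 t :=
    intervalIntegral.integral_congr fun t _ ↦ by ring
  rw [hsimp]
  have hmono : ∫ t in x..X, (ψ t - θ t) * w0 t ≤
      ∫ t in x..X, (c * (t ^ (1 / 2 : ℝ) * w0 t) + 4 / 3 * (t ^ ((1 : ℝ) / 3) * w0 t)) := by
    refine intervalIntegral.integral_mono_on hX (hiψ.sub hiθ |>.congr ?_)
      ((hi2.const_mul c).add (hi3.const_mul _)) fun t ht ↦ ?_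
    · exact fun t _ ↦ by ring
    · have ht1 : 1 < t := hx.trans_le ht.1
      have h := hψθ t ht.1
      rw [Real.sqrt_eq_rpow] at h
      have hw := (w0_pos ht1).le
      calc (ψ t - θ t) * w0 t ≤ (c * t ^ (1 / 2 : ℝ) + 4 / 3 * t ^ ((1 : ℝ) / 3)) * w0 t :=
            mul_le_mul_of_nonneg_right h hw
        _ = _ := by ring
  refine hmono.trans ?_
  rw [intervalIntegral.integral_add (hi2.const_mul c) (hi3.const_mul _),
    intervalIntegral.integral_const_mul, intervalIntegral.integral_const_mul]
  have h2 := integral_rpow_mul_w0_le_Fz (a := 1 / 2) (by norm_num) hx hX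
  have h3 := integral_rpow_mul_w0_le_Fz (a := (1 : ℝ) / 3) (by norm_num) hx hX
  have h2' : c * ∫ t in x..X, t ^ (1 / 2 : ℝ) * w0 t ≤ c * (Fz (1 / 2 : ℝ) x).re :=
    mul_le_mul_of_nonneg_left h2 hc
  have h3' : 4 / 3 * ∫ t in x..X, t ^ ((1 : ℝ) / 3) * w0 t ≤ 4 / 3 * (Fz (1 / 3 : ℝ) x).re := by
    rw [show ((1 : ℝ) / 3) = (1 / 3 : ℝ) by norm_num] at h3 ⊢
    linarith
  linarith

/-! ### The window hypothesis discharged (Büthe 2018 below `10¹⁹`; Büthe 2016 + Platt–Trudgian below `2.169·10²⁵`) -/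

/-- `log 1423 ≥ 7.2` (`1423 = 2¹⁰ · (1423/1024)`, `log z ≥ 1 − 1/z`). -/
theorem log_1423_ge : (7.2 : ℝ) ≤ Real.log 1423 := by
  have h2 := Real.log_two_gt_d9
  have hsplit : Real.log 1423 = 10 * Real.log 2 + Real.log (1423 / 1024) := by
    rw [show (1423 : ℝ) = 2 ^ 10 * (1423 / 1024) by norm_num, Real.log_mul (by norm_num) (by norm_num),
      Real.log_pow]
    norm_num
  have h3 : 1 - (1423 / 1024 : ℝ)⁻¹ ≤ Real.log (1423 / 1024) := Real.one_sub_inv_le_log_of_pos (by norm_num)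
  rw [hsplit]
  norm_num at h3 ⊢
  linarith

/-- **The window hypothesis below `10¹⁹` reduces, RH-free, to the FIXED finite range `[599, 1423]`**:
Büthe 2018, Thm 2 (line 2) gives `|θ(y) − y| ≤ 1.95√y ≤ √y·log²y/(8π)` for `1423 ≤ y ≤ 10¹⁹`. -/
theorem schoenfeldThetaOn_of_buthe (hB : Buthe2018_thm2_theta) (h0 : ∀ y : ℝ, 599 ≤ y → y ≤ 1423 → |θ y - y| ≤ √y * Real.log y ^ 2 / (8 * π))
    {x : ℝ} (hx : x ≤ (10 : ℝ) ^ 19) :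
    ∀ y : ℝ, 599 ≤ y → y ≤ x → |θ y - y| ≤ √y * Real.log y ^ 2 / (8 * π) := by
  intro y hy hyx
  rcases le_or_gt y 1423 with h1 | h1
  · exact h0 y hy h1
  · have hB' := hB.abs_sub_le h1.le (hyx.trans hx)
    have hlog : 7.2 ≤ Real.log y :=
      log_1423_ge.trans (Real.log_le_log (by norm_num) h1.le)
    have hl2 : (51.84 : ℝ) ≤ Real.log y ^ 2 := by nlinarith
    have hpi := Real.pi_lt_d4
    have hs : 0 ≤ Real.sqrt y := Real.sqrt_nonneg y
    have hkey : 1.95 * Real.sqrt y ≤ Real.sqrt y * Real.log y ^ 2 / (8 * π) := by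
      rw [le_div_iff₀ (by positivity)]
      nlinarith
    exact hB'.trans hkey

/-- `θ` is constant on `[599, 600)`: `θ y = θ 599`. -/
theorem theta_eq_599 {y : ℝ} (h1 : 599 ≤ y) (h2 : y < 600) : θ y = θ 599 := by
  rw [Chebyshev.theta_eq_theta_coe_floor y, Chebyshev.theta_eq_theta_coe_floor 599]
  have hf : ⌊y⌋₊ = 599 := by
    rw [Nat.floor_eq_iff (by linarith)]
    exact ⟨by exact_mod_cast h1, by push_cast; linarith⟩
  have hf' : ⌊(599 : ℝ)⌋₊ = 599 := by
    rw [Nat.floor_eq_iff (by norm_num)]; norm_num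
  rw [hf, hf']

/-- **The window hypothesis from RH verified to height `3·10¹²`** (Büthe 2016 Thm 2 + Platt–Trudgian 2021):
`Buthe2016_thm2 → RiemannHypothesisUpTo 3000175332800 →` the window bound on `[599, x]` for every `x ≤ 2.169·10²⁵`
(the endpoint `y = 599`, excluded in Büthe's strict `599 < y`, by right-continuity of the step function `θ`). -/
theorem schoenfeldThetaOn_of_buthe2016 (h : Buthe2016_thm2) (hRH : RiemannHypothesisUpTo 3000175332800)
    {x : ℝ} (hx : x ≤ 2.169e25) :
    ∀ y : ℝ, 599 ≤ y → y ≤ x → |θ y - y| ≤ √y * Real.log y ^ 2 / (8 * π) := by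
  have hB : ∀ y : ℝ, 599 < y → y ≤ 2.169e25 → |θ y - y| ≤ √y * Real.log y ^ 2 / (8 * π) := by
    intro y hy hy'
    have h1 := (Buthe2016_thm2.plattTrudgian_range h hRH (by linarith) hy').2.1 hy
    calc |θ y - y| ≤ Real.sqrt y / (8 * π) * Real.log y ^ 2 := h1
      _ = _ := by ring
  intro y hy hyx
  rcases hy.lt_or_eq with hlt | heq
  · exact hB y hlt (hyx.trans hx)
  · rw [← heq]
    -- right limit along `u n = 599 + 1/(2(n+1))`
    set u : ℕ → ℝ := fun n ↦ 599 + 1 / 2 * (1 / ((n : ℝ) + 1)) with hu_def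
    have hu0 : ∀ n, 599 < u n ∧ u n < 600 := fun n ↦ by
      have h1 : 0 < 1 / ((n : ℝ) + 1) := by positivity
      have h2 : 1 / ((n : ℝ) + 1) ≤ 1 := by
        rw [div_le_one (by positivity)]; linarith [n.cast_nonneg (α := ℝ)]
      constructor <;> simp only [hu_def] <;> linarith
    have hu : Tendsto u atTop (𝓝 599) := by
      have h := (tendsto_one_div_add_atTop_nhds_zero_nat).const_mul (1 / 2 : ℝ)
      have h2 := h.const_add (599 : ℝ)
      rw [mul_zero, add_zero] at h2
      exact h2
    have hbound : ∀ n, |θ 599 - u n| ≤ Real.sqrt (u n) * Real.log (u n) ^ 2 / (8 * π) := fun n ↦ by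
      have h := hB (u n) (hu0 n).1 (by linarith [(hu0 n).2])
      rwa [theta_eq_599 (hu0 n).1.le (hu0 n).2] at h
    have hL : Tendsto (fun n ↦ |θ 599 - u n|) atTop (𝓝 |θ 599 - 599|) :=
      ((continuous_const.sub continuous_id).abs.tendsto 599).comp hu
    have hR : Tendsto (fun n ↦ Real.sqrt (u n) * Real.log (u n) ^ 2 / (8 * π)) atTop
        (𝓝 (Real.sqrt 599 * Real.log 599 ^ 2 / (8 * π))) := by
      have hc : ContinuousAt (fun y : ℝ ↦ Real.sqrt y * Real.log y ^ 2 / (8 * π)) 599 :=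
        ((Real.continuous_sqrt.continuousAt).mul ((Real.continuousAt_log (by norm_num)).pow 2)).div_const _
      exact hc.tendsto.comp hu
    exact le_of_tendsto_of_tendsto' hL hR hbound

end Summit.RiemannHypothesis.RiemannHypothesis.Theorems.Splittings.RobinFiniteE1c

end
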